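import Literature.NumberTheory.Sieve.Maynard2016Prop92MainDecomposition
import HarnessLib

/-!
# Maynard 2016, proof of Lemma 9.3 — the constant of the main term (display (9.30))

Sources: J. Maynard, *Dense clusters of primes in subsets*, Compositio Math. 152 (2016) 1517–1554 =
arXiv:1405.2593 [Maynard2016DenseClusters], proof of Lemma 9.3, p. 24 (display (9.30), «eq. YmMain»);
K. Ford, B. Green, S. Konyagin, J. Maynard, T. Tao, *Long gaps between primes*, JAMS 31 (2018)
[FordGreenKonyaginMaynardTao2018], Theorem 6 (7.13).

The last step of the main-term evaluation of `y^{(m)}_r` (leaf M2 `Maynard2016Lemma93Z`): after the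
`(s,t)`-Euler product (9.28) and the `e_m`-summation (9.29), the prefactor collapses to the constant `c_m` of
Lemma 9.3 (the tree's `FGKMT2018.cM`):
`log R · (W^kB^k 𝔖_{WB}/φ(WB)^k) · (r/φ_L(r)) ∏_{p ∣ r}(1 − 1/p) ∏_{p ∣ WBa_m, p ∤ r}(1 − 1/p) ∫ H dt_m
 = log R · φ(a_mWB)W^{k−1}B^{k−1}𝔖_{WB}/(a_m φ(WB)^k) ∫ H dt_m` («here we have used `(r, WB) = 1`»).
This file proves the two exact identities behind it, in the tree's encoding (`a = |a_m| = (L m).1.natAbs`,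
`WB = wCut k B · B`, `φ_L = totForm (L m)`, `y`-prefactor `yPref L B = (WB)^k 𝔖_{WB}/φ(WB)^k`):
* `totient_div_self_eq_prod` — `φ(n)/n = ∏_{p ∣ n}(1 − 1/p)` (the Euler-product form in which (9.28)–(9.29) deliver it);
* `totient_mul_totient_mul_mul` — `φ(a)·φ(a·n·W) = φ(a·n)·φ(a·W)` for `(n, W) = 1`;
* `div_totForm_mul_totient_div` — `(n/φ_L(n)) · φ(a·W·n)/(a·W·n) = φ(a·W)/(a·W)` for `(n, W) = 1`, `n ≠ 0`,
  and its instance `prod_div_totForm_mul_totient_div` for `r ∈ 𝒟'ₖ⁽ᵐ⁾` (`n = ∏ rᵢ`, `W = wCut k B · B`);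
* `cM_eq_yPref_mul` — `c_m = yPref · φ(a·WB)/(a·WB)` (`k ≥ 1`); `cM_eq_yPref_mul_prod` — `= yPref · ∏_{p ∣ a·WB}(1 − 1/p)`.

## References
* J. Maynard, *Dense clusters of primes in subsets*, Compositio Math. 152 (2016), proof of Lemma 9.3 p. 24,
  display (9.30) [Maynard2016DenseClusters].
* K. Ford, B. Green, S. Konyagin, J. Maynard, T. Tao, *Long gaps between primes*, JAMS 31 (2018), Thm 6 (7.13)
  [FordGreenKonyaginMaynardTao2018].
-/

noncomputable section

open Finset

namespace Literature.NumberTheory.Sieve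

namespace FGKMT2018

variable {k : ℕ}

/-- `φ(n)/n = ∏_{p ∣ n} (1 − 1/p)` for `n ≠ 0`.
[cite: Maynard2016DenseClusters, proof of Lemma 9.3 p. 24, (9.29)–(9.30)] -/
theorem totient_div_self_eq_prod {n : ℕ} (hn : n ≠ 0) :
    (Nat.totient n : ℝ) / n = ∏ p ∈ n.primeFactors, (1 - 1 / (p : ℝ)) := by
  have h := Nat.totient_mul_prod_primeFactors n
  have hP : (∏ p ∈ n.primeFactors, (p : ℝ)) ≠ 0 :=
    Finset.prod_ne_zero_iff.2 fun p hp => by exact_mod_cast (Nat.prime_of_mem_primeFactors hp).ne_zero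
  have hcast : (Nat.totient n : ℝ) * ∏ p ∈ n.primeFactors, (p : ℝ) =
      (n : ℝ) * ∏ p ∈ n.primeFactors, ((p : ℝ) - 1) := by
    have := congrArg (fun x : ℕ => (x : ℝ)) h
    simp only [Nat.cast_mul, Nat.cast_prod] at this
    rw [this]
    congr 1
    refine Finset.prod_congr rfl fun p hp => ?_
    rw [Nat.cast_sub (Nat.prime_of_mem_primeFactors hp).one_le, Nat.cast_one]
  have hn' : (n : ℝ) ≠ 0 := by exact_mod_cast hn
  rw [div_eq_iff hn', show ∏ p ∈ n.primeFactors, (1 - 1 / (p : ℝ)) =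
      (∏ p ∈ n.primeFactors, ((p : ℝ) - 1)) / ∏ p ∈ n.primeFactors, (p : ℝ) by
    rw [← Finset.prod_div_distrib]
    refine Finset.prod_congr rfl fun p hp => ?_
    have hp0 : (p : ℝ) ≠ 0 := by exact_mod_cast (Nat.prime_of_mem_primeFactors hp).ne_zero
    field_simp]
  rw [div_mul_eq_mul_div, eq_div_iff hP, hcast]
  ring

/-- `φ(a)·φ(a·n·W) = φ(a·n)·φ(a·W)` when `(n, W) = 1` (both sides count the prime sets of `a`, `n`, `W`
the same way). [cite: Maynard2016DenseClusters, proof of Lemma 9.3 p. 24, (9.30)] -/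
theorem totient_mul_totient_mul_mul (a n W : ℕ) (hnW : Nat.Coprime n W) :
    Nat.totient a * Nat.totient (a * n * W) = Nat.totient (a * n) * Nat.totient (a * W) := by
  rcases Nat.eq_zero_or_pos a with rfl | ha
  · simp
  -- `gcd(a n, a W) = a`, so `φ(a) φ(a n · a W) = φ(a n) φ(a W) a`
  have hg : (a * n).gcd (a * W) = a := by rw [Nat.gcd_mul_left, hnW, mul_one]
  have h1 := Nat.totient_gcd_mul_totient_mul (a * n) (a * W)
  rw [hg] at h1
  -- `gcd(a, a n W) = a`, so `φ(a) φ(a · a n W) = φ(a) φ(a n W) a`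
  have hg' : a.gcd (a * n * W) = a := Nat.gcd_eq_left (dvd_mul_of_dvd_left (dvd_mul_right a n) W)
  have h2 := Nat.totient_gcd_mul_totient_mul a (a * n * W)
  rw [hg'] at h2
  have hφa : 0 < Nat.totient a := Nat.totient_pos.2 ha
  have e : a * n * (a * W) = a * (a * n * W) := by ring
  rw [e] at h1
  -- cancel `φ(a) · a`
  have h3 : Nat.totient a * (Nat.totient a * Nat.totient (a * n * W) * a) =
      Nat.totient a * (Nat.totient (a * n) * Nat.totient (a * W) * a) := by
    rw [← h2, h1]
  have h4 := Nat.eq_of_mul_eq_mul_left hφa h3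
  exact Nat.eq_of_mul_eq_mul_right ha h4

/-- **`(n/φ_L(n)) · φ(a·W·n)/(a·W·n) = φ(a·W)/(a·W)`** for `(n, W) = 1`, `n ≠ 0`
(`φ_L(n) = φ(a n)/φ(a)`, `a = |a_m|`). [cite: Maynard2016DenseClusters, proof of Lemma 9.3 p. 24, (9.30)] -/
theorem div_totForm_mul_totient_div (l : ℤ × ℤ) {n W : ℕ} (hn : n ≠ 0) (hnW : Nat.Coprime n W) :
    (n : ℝ) / totForm l n * ((Nat.totient (l.1.natAbs * W * n) : ℝ) / ((l.1.natAbs * W * n : ℕ) : ℝ)) =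
      (Nat.totient (l.1.natAbs * W) : ℝ) / ((l.1.natAbs * W : ℕ) : ℝ) := by
  set a := l.1.natAbs with ha_def
  rcases Nat.eq_zero_or_pos a with ha0 | ha
  · simp [totForm, ← ha_def, ha0]
  rcases Nat.eq_zero_or_pos W with rfl | hW
  · simp
  have hid := totient_mul_totient_mul_mul a n W hnW
  have hφa : (Nat.totient a : ℝ) ≠ 0 := by exact_mod_cast (Nat.totient_pos.2 ha).ne'
  have hφan : (Nat.totient (a * n) : ℝ) ≠ 0 := by
    exact_mod_cast (Nat.totient_pos.2 (Nat.mul_pos ha (Nat.pos_of_ne_zero hn))).ne'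
  have hn' : (n : ℝ) ≠ 0 := by exact_mod_cast hn
  have ha' : (a : ℝ) ≠ 0 := by exact_mod_cast ha.ne'
  have hW' : (W : ℝ) ≠ 0 := by exact_mod_cast hW.ne'
  have hidR : (Nat.totient a : ℝ) * Nat.totient (a * n * W) = Nat.totient (a * n) * Nat.totient (a * W) := by
    exact_mod_cast hid
  unfold totForm
  rw [← ha_def, show a * W * n = a * n * W by ring]
  push_cast
  field_simp
  linear_combination hidR

/-- The instance for `r ∈ 𝒟'ₖ⁽ᵐ⁾` (`n = ∏ rᵢ` is coprime to `WB`):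
`(∏ rᵢ/φ_L(∏ rᵢ)) · φ(a·WB·∏ rᵢ)/(a·WB·∏ rᵢ) = φ(a·WB)/(a·WB)`.
[cite: Maynard2016DenseClusters, proof of Lemma 9.3 p. 24, (9.30) («r ∈ 𝒟'_k, so (r, WB) = 1»)] -/
theorem prod_div_totForm_mul_totient_div {L : Fin k → ℤ × ℤ} {B : ℕ} {R : ℝ} {m : Fin k}
    {r : Fin k → ℕ} (hr : r ∈ dkBoxP L B R m) :
    ((∏ i, r i : ℕ) : ℝ) / totForm (L m) (∏ i, r i) *
        ((Nat.totient ((L m).1.natAbs * (wCut k B * B) * ∏ i, r i) : ℝ) /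
          (((L m).1.natAbs * (wCut k B * B) * ∏ i, r i : ℕ) : ℝ)) =
      (Nat.totient ((L m).1.natAbs * (wCut k B * B)) : ℝ) / (((L m).1.natAbs * (wCut k B * B) : ℕ) : ℝ) := by
  have hrbox := dkBoxP_subset L B R m hr
  have hn : (∏ i, r i) ≠ 0 := (Finset.prod_pos fun i _ => one_le_of_mem_dkBox hrbox i).ne'
  have hcop : Nat.Coprime (∏ i, r i) (wCut k B * B) := (mem_dkBox_iff.1 hrbox).2.2.1
  exact div_totForm_mul_totient_div (L m) hn hcop

/-- **`c_m = yPref · φ(a·WB)/(a·WB)`** (`k ≥ 1`): the constant of Lemma 9.3 is the `y`-prefactor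
`(WB)^k 𝔖_{WB}/φ(WB)^k` times `φ(|a_m|WB)/(|a_m|WB)`.
[cite: Maynard2016DenseClusters, Lemma 9.3 (9.14) and its proof p. 24, (9.30)] -/
theorem cM_eq_yPref_mul (hk : 1 ≤ k) (L : Fin k → ℤ × ℤ) (B : ℕ) (m : Fin k) :
    cM L B m = yPref L B *
      ((Nat.totient ((L m).1.natAbs * (wCut k B * B)) : ℝ) / (((L m).1.natAbs * (wCut k B * B) : ℕ) : ℝ)) := by
  unfold cM yPref
  set a := (L m).1.natAbs
  set WB := wCut k B * B
  rcases Nat.eq_zero_or_pos a with ha0 | ha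
  · simp [ha0]
  rcases Nat.eq_zero_or_pos WB with hWB0 | hWB
  · have hk0 : k ≠ 0 := by omega
    simp [hWB0, zero_pow hk0]
  have ha' : (a : ℝ) ≠ 0 := by exact_mod_cast ha.ne'
  have hWB' : (WB : ℝ) ≠ 0 := by exact_mod_cast hWB.ne'
  have hφ : (Nat.totient WB : ℝ) ≠ 0 := by exact_mod_cast (Nat.totient_pos.2 hWB).ne'
  obtain ⟨j, rfl⟩ : ∃ j, k = j + 1 := ⟨k - 1, by omega⟩
  simp only [Nat.add_sub_cancel, pow_succ]
  push_cast
  field_simp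

/-- The Euler-product form: `c_m = yPref · ∏_{p ∣ a·WB}(1 − 1/p)` (`k ≥ 1`, `a·WB ≠ 0`) — the shape in which
the `(s,t)`-product (9.28) and the `e_m`-summation (9.29) deliver the constant.
[cite: Maynard2016DenseClusters, Lemma 9.3 (9.14) and its proof p. 24, (9.28)–(9.30)] -/
theorem cM_eq_yPref_mul_prod (hk : 1 ≤ k) (L : Fin k → ℤ × ℤ) {B : ℕ} (m : Fin k)
    (h0 : (L m).1.natAbs * (wCut k B * B) ≠ 0) :
    cM L B m = yPref L B * ∏ p ∈ ((L m).1.natAbs * (wCut k B * B)).primeFactors, (1 - 1 / (p : ℝ)) := by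
  rw [cM_eq_yPref_mul hk, totient_div_self_eq_prod h0]

end FGKMT2018

end Literature.NumberTheory.Sieve
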